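import Summits.CriticalPhenomena.Ising3D.Control2DCellCheck2
import Mathlib.Tactic.NormNum
import HarnessLib

/-!
# The 2D control: soundness of the second-order kernel checker for obligation (C)
(cell `pub-ising3x`, seat controls-1; companion of `Control2DCellCheck2.lean` / `Control2DCellScheme2.lean`)

HONEST FRAMING: lottery ticket; floor = tightest certified 3D Ising CFT bounds; no exact-solution
claim without a proof.

`divDy_mem`/`mulDy_mem` (dyadic widths), the minorant with an optional left stencil (`quadLB_le_PsiC'`),
the real coefficients `Aq, Bq, Cq` with `quadLB τ = Aq + Bq τ + Cq τ²` (`quadLB_eq`), and the integer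
bounds `sums6_spec`. The test / cell / cut-list layer is `Control2DCellSpin2.lean`. All PROVED.
-/

namespace Summit.CriticalPhenomena.Ising3D.Control2D

open Set Finset
open Literature.MathematicalPhysics.QuantumFieldTheory.ConformalBootstrap3D

/-! ### Dyadic widths -/

/-- A dyadic `H` reads `dyNum H / 2^(dyExp H)` in `ℝ`. [folklore] -/
theorem dy_cast {H : ℚ} (h : dyOK H = true) : (H : ℝ) = (dyNum H : ℝ) / 2 ^ dyExp H := dyOK_cast h

/-- [folklore] -/
theorem dyNum_pos {H : ℚ} (h : dyOK H = true) (hH : 0 < H) : 0 < dyNum H := by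
  have e := dy_cast h
  have hH' : (0 : ℝ) < (H : ℝ) := by exact_mod_cast hH
  rw [e] at hH'
  have : (0 : ℝ) < (dyNum H : ℝ) := by
    by_contra hc; push Not at hc
    have : (dyNum H : ℝ) / 2 ^ dyExp H ≤ 0 := div_nonpos_of_nonpos_of_nonneg hc (by positivity)
    linarith
  exact_mod_cast this

/-- `divDy I H ∋ x / H`. [folklore] -/
theorem divDy_mem {P : ℕ} {I : NI} {x : ℝ} (hx : I.mem P x) {H : ℚ} (h : dyOK H = true) (hH : 0 < H) :
    (divDy I H).mem P (x / (H : ℝ)) := by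
  have e : x / (H : ℝ) = ((2 ^ dyExp H : ℕ) : ℝ) * x / (dyNum H : ℝ) := by
    rw [dy_cast h]; push_cast; field_simp
  rw [e]
  exact NI.mem_divNat (dyNum_pos h hH) (NI.mem_mulNat _ hx)

/-- `mulDy I H ∋ x · H`. [folklore] -/
theorem mulDy_mem {P : ℕ} {I : NI} {x : ℝ} (hx : I.mem P x) {H : ℚ} (h : dyOK H = true) :
    (mulDy I H).mem P (x * (H : ℝ)) := by
  have e : x * (H : ℝ) = ((dyNum H : ℕ) : ℝ) * x / ((2 ^ dyExp H : ℕ) : ℝ) := by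
    rw [dy_cast h]; push_cast; ring
  rw [e]
  exact NI.mem_divNat (by positivity) (NI.mem_mulNat _ hx)

/-! ### The real coefficients of the quadratic minorant -/

section coeffs
variable (rds : List RDat) (N ℓ : ℕ) (useD0 : Bool) (tm t₀ t₁ t₂ : ℝ)

/-- `A = Σ_+ c α₀ b₀ - Σ_- c f₀ b₀` (products left-associated, as the checker forms them). [folklore] -/
noncomputable def Aq : ℝ :=
  (rds.map fun d =>
    if d.σ then d.c * (fC d.x d.y t₁ + (t₁ - t₀) * ((fC d.x d.y t₁ - fC d.x d.y t₂) / (t₂ - t₁))) *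
      brR N ℓ t₀ d.x d.y
    else -(d.c * fC d.x d.y t₀ * brR N ℓ t₀ d.x d.y)).sum

/-- `B = Σ_+ (c α₀ D₀ - c D₃ b₀) - Σ_- (c f₀ U - c D₁ b₀)`. [folklore] -/
noncomputable def Bq : ℝ :=
  (rds.map fun d =>
    if d.σ then
      d.c * (fC d.x d.y t₁ + (t₁ - t₀) * ((fC d.x d.y t₁ - fC d.x d.y t₂) / (t₂ - t₁))) *
          D0of useD0 (fun t => brR N ℓ t d.x d.y) tm t₀ -
        d.c * ((fC d.x d.y t₁ - fC d.x d.y t₂) / (t₂ - t₁)) * brR N ℓ t₀ d.x d.y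
    else
      -(d.c * fC d.x d.y t₀ * ((brR N ℓ t₁ d.x d.y - brR N ℓ t₀ d.x d.y) / (t₁ - t₀))) +
        d.c * ((fC d.x d.y t₀ - fC d.x d.y t₁) / (t₁ - t₀)) * brR N ℓ t₀ d.x d.y).sum

/-- `C = -Σ_+ c D₃ D₀ + Σ_- c D₁ U`. [folklore] -/
noncomputable def Cq : ℝ :=
  (rds.map fun d =>
    if d.σ then -(d.c * ((fC d.x d.y t₁ - fC d.x d.y t₂) / (t₂ - t₁)) *
      D0of useD0 (fun t => brR N ℓ t d.x d.y) tm t₀)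
    else d.c * ((fC d.x d.y t₀ - fC d.x d.y t₁) / (t₁ - t₀)) *
      ((brR N ℓ t₁ d.x d.y - brR N ℓ t₀ d.x d.y) / (t₁ - t₀))).sum

end coeffs

/-- `quadLB τ = A + B τ + C τ²`. [folklore] -/
theorem quadLB_eq (rds : List RDat) (N ℓ : ℕ) (useD0 : Bool) (tm t₀ t₁ t₂ τ : ℝ) :
    quadLB rds N ℓ useD0 tm t₀ t₁ t₂ τ =
      Aq rds N ℓ t₀ t₁ t₂ + Bq rds N ℓ useD0 tm t₀ t₁ t₂ * τ + Cq rds N ℓ useD0 tm t₀ t₁ t₂ * τ ^ 2 := by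
  induction rds with
  | nil => simp [quadLB, Aq, Bq, Cq]
  | cons d tl ih =>
    simp only [quadLB, Aq, Bq, Cq, List.map_cons, List.sum_cons] at ih ⊢
    rw [ih]
    cases d.σ <;> simp <;> ring

/-! ### The minorant with an optional left stencil -/

/-- `D0of` is a valid supporting slope; the stencil facts are needed only when `useD0`. [folklore] -/
theorem D0of_spec' (useD0 : Bool) {b : ℝ → ℝ} {ℓ tm t₀ τ : ℝ} (hb : ConvexOn ℝ (Ici ℓ) b)
    (hbm : ∀ u v, ℓ ≤ u → u ≤ v → b u ≤ b v) (hℓ0 : ℓ ≤ t₀)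
    (hm : useD0 = true → ℓ ≤ tm ∧ tm < t₀) (hτ : 0 ≤ τ) :
    0 ≤ D0of useD0 b tm t₀ ∧ b t₀ + D0of useD0 b tm t₀ * τ ≤ b (t₀ + τ) := by
  cases hu : useD0
  · unfold D0of
    simp only [Bool.false_eq_true, ↓reduceIte, zero_mul, add_zero, le_refl, true_and]
    exact hbm _ _ hℓ0 (by linarith)
  · obtain ⟨h1, h2⟩ := hm hu
    exact D0of_spec true hb hbm h1 h2 hτ

/-- **`Ψ(t₀+τ) ≥ quadLB … τ`** with the left-stencil facts required only when `useD0`. [folklore] -/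
theorem quadLB_le_PsiC' {rds : List RDat} (h : ∀ d ∈ rds, d.ok) (N ℓ : ℕ) (useD0 : Bool)
    {tm t₀ t₁ t₂ τ : ℝ} (hℓ0 : (ℓ : ℝ) ≤ t₀) (hm : useD0 = true → (ℓ : ℝ) ≤ tm ∧ tm < t₀)
    (h01 : t₀ < t₁) (h12 : t₁ < t₂) (hτ0 : 0 ≤ τ) (hτ1 : τ ≤ t₁ - t₀) :
    quadLB rds N ℓ useD0 tm t₀ t₁ t₂ τ ≤ PsiC rds N ℓ (t₀ + τ) := by
  induction rds with
  | nil => simp [quadLB, PsiC]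
  | cons d tl ih =>
    have htl : ∀ d' ∈ tl, d'.ok := fun d' hd' => h d' (List.mem_cons_of_mem _ hd')
    have hd := h d List.mem_cons_self
    have ih' := ih htl
    obtain ⟨hc, hx, hx1, hy, hy1⟩ := hd
    have fconv := convexOn_fC hx hy
    have fanti : ∀ u v : ℝ, u ≤ v → fC d.x d.y v ≤ fC d.x d.y u := fun u v huv => fC_antitone hx hx1 hy hy1 huv
    have fpos : ∀ u, 0 ≤ fC d.x d.y u := fun u => fC_nonneg hx hy u
    have bconv := convexOn_brR N ℓ hx hy
    have bmono : ∀ u v : ℝ, (ℓ : ℝ) ≤ u → u ≤ v → brR N ℓ u d.x d.y ≤ brR N ℓ v d.x d.y :=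
      fun u v hu huv => brR_mono N ℓ hu huv hx hy
    have bpos : ∀ u, (ℓ : ℝ) ≤ u → 0 ≤ brR N ℓ u d.x d.y := fun u hu => brR_nonneg N ℓ hu hx hy
    simp only [quadLB, PsiC, List.map_cons, List.sum_cons] at ih' ⊢
    cases d.σ
    · simp only [Bool.false_eq_true, ↓reduceIte, neg_mul, one_mul]
      have := neg_term_bound fconv fpos bconv bpos hc hℓ0 h01 hτ0 hτ1
      linarith
    · simp only [↓reduceIte, one_mul]
      obtain ⟨hD0, hbl⟩ := D0of_spec' useD0 (b := fun Δ => brR N ℓ Δ d.x d.y) bconv bmono hℓ0 hm hτ0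
      have := pos_term_bound (b := fun Δ => brR N ℓ Δ d.x d.y) fconv fanti fpos hc h12 hτ0 hτ1
        (bpos t₀ hℓ0) hD0 hbl
      linarith

/-! ### The integer bounds -/

/-- **`sums6` bounds `A, B, C` from below** (scale `2^P`), given the point enclosures at `t₋`, `t₀`,
`t₁`, `t₂` and the order facts `ℓ ≤ t₋ < t₀ < t₁ < t₂` (the `t₋` enclosures are used only when
`useD0`; any list related to the data will do otherwise). [folklore] -/
theorem sums6_spec {P N ℓ : ℕ} {vals : List ℚ} {cds : List CDat} {rds : List RDat}
    (h : List.Forall₂ (CDat.Models P vals ℓ) cds rds) (hok : ∀ r ∈ rds, r.ok) {useD0 : Bool}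
    {tm t₀ t₁ t₂ : ℝ} (hℓ0 : (ℓ : ℝ) ≤ t₀) (hm : useD0 = true → (ℓ : ℝ) ≤ tm ∧ tm < t₀)
    (h01 : t₀ < t₁) (h12 : t₁ < t₂)
    {H0 H H3 : ℚ} (hH0 : useD0 = true → dyOK H0 = true ∧ (H0 : ℝ) = t₀ - tm) (dH : dyOK H = true)
    (dH3 : dyOK H3 = true) (eH : (H : ℝ) = t₁ - t₀) (eH3 : (H3 : ℝ) = t₂ - t₁)
    {pm p0 p1 p2 : List (NI × NI)}
    (hpm : List.Forall₂ (fun pr r => useD0 = true →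
      (pr.1.mem P (fC r.x r.y tm) ∧ pr.2.mem P (brR N ℓ tm r.x r.y))) pm rds)
    (hp0 : List.Forall₂ (fun pr r => pr.1.mem P (fC r.x r.y t₀) ∧ pr.2.mem P (brR N ℓ t₀ r.x r.y)) p0 rds)
    (hp1 : List.Forall₂ (fun pr r => pr.1.mem P (fC r.x r.y t₁) ∧ pr.2.mem P (brR N ℓ t₁ r.x r.y)) p1 rds)
    (hp2 : List.Forall₂ (fun pr r => pr.1.mem P (fC r.x r.y t₂) ∧ pr.2.mem P (brR N ℓ t₂ r.x r.y)) p2 rds) :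
    ((sums6 P useD0 H0 H H3 cds pm p0 p1 p2).1 : ℝ) ≤ Aq rds N ℓ t₀ t₁ t₂ * 2 ^ P ∧
    ((sums6 P useD0 H0 H H3 cds pm p0 p1 p2).2.1 : ℝ) ≤ Bq rds N ℓ useD0 tm t₀ t₁ t₂ * 2 ^ P ∧
    ((sums6 P useD0 H0 H H3 cds pm p0 p1 p2).2.2 : ℝ) ≤ Cq rds N ℓ useD0 tm t₀ t₁ t₂ * 2 ^ P := by
  have hHp : 0 < H := by
    have : (0 : ℝ) < (H : ℝ) := by rw [eH]; linarith
    exact_mod_cast this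
  have hH3p : 0 < H3 := by
    have : (0 : ℝ) < (H3 : ℝ) := by rw [eH3]; linarith
    exact_mod_cast this
  induction h generalizing pm p0 p1 p2 with
  | nil =>
    cases hpm; cases hp0; cases hp1; cases hp2
    simp [sums6, Aq, Bq, Cq]
  | @cons d r dtl rtl hd _ ih =>
    cases hpm with | @cons qm _ pmt _ ham hpm' =>
    cases hp0 with | @cons q0 _ p0t _ ha0 hp0' =>
    cases hp1 with | @cons q1 _ p1t _ ha1 hp1' =>
    cases hp2 with | @cons q2 _ p2t _ ha2 hp2' =>
    obtain ⟨i1, i2, i3⟩ := ih (fun r' hr' => hok r' (List.mem_cons_of_mem _ hr')) hpm' hp0' hp1' hp2'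
    have hr := hok r List.mem_cons_self
    obtain ⟨hc0, hx, hx1, hy, hy1⟩ := hr
    have hc := hd.cabs
    -- order facts
    have f12 : fC r.x r.y t₂ ≤ fC r.x r.y t₁ := fC_antitone hx hx1 hy hy1 h12.le
    have f01 : fC r.x r.y t₁ ≤ fC r.x r.y t₀ := fC_antitone hx hx1 hy hy1 h01.le
    have b01 : brR N ℓ t₀ r.x r.y ≤ brR N ℓ t₁ r.x r.y := brR_mono N ℓ hℓ0 h01.le hx hy
    -- derived enclosures
    have mD3 : (divDy (q1.1.subT q2.1) H3).mem P ((fC r.x r.y t₁ - fC r.x r.y t₂) / (t₂ - t₁)) := by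
      rw [← eH3]; exact divDy_mem (NI.mem_subT ha1.1 ha2.1 f12) dH3 hH3p
    have ma0 : (q1.1.add (mulDy (divDy (q1.1.subT q2.1) H3) H)).mem P
        (fC r.x r.y t₁ + (t₁ - t₀) * ((fC r.x r.y t₁ - fC r.x r.y t₂) / (t₂ - t₁))) := by
      have := NI.mem_add ha1.1 (mulDy_mem mD3 dH)
      rw [eH] at this
      have e : (fC r.x r.y t₁ - fC r.x r.y t₂) / (t₂ - t₁) * (t₁ - t₀) =
          (t₁ - t₀) * ((fC r.x r.y t₁ - fC r.x r.y t₂) / (t₂ - t₁)) := by ring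
      rw [e] at this; exact this
    have mD0 : (if useD0 then divDy (q0.2.subT qm.2) H0 else NI.zero).mem P
        (D0of useD0 (fun t => brR N ℓ t r.x r.y) tm t₀) := by
      cases hu : useD0
      · simp only [Bool.false_eq_true, ↓reduceIte, D0of]; exact NI.mem_zero P
      · simp only [↓reduceIte, D0of]
        obtain ⟨hm1, hm2⟩ := hm hu
        obtain ⟨dH0, eH0⟩ := hH0 hu
        have hH0p : 0 < H0 := by
          have : (0 : ℝ) < (H0 : ℝ) := by rw [eH0]; linarith
          exact_mod_cast this
        have bm0 : brR N ℓ tm r.x r.y ≤ brR N ℓ t₀ r.x r.y := brR_mono N ℓ hm1 hm2.le hx hy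
        rw [← eH0]
        exact divDy_mem (NI.mem_subT ha0.2 (ham hu).2 bm0) dH0 hH0p
    have mD1 : (divDy (q0.1.subT q1.1) H).mem P ((fC r.x r.y t₀ - fC r.x r.y t₁) / (t₁ - t₀)) := by
      rw [← eH]; exact divDy_mem (NI.mem_subT ha0.1 ha1.1 f01) dH hHp
    have mU : (divDy (q1.2.subT q0.2) H).mem P ((brR N ℓ t₁ r.x r.y - brR N ℓ t₀ r.x r.y) / (t₁ - t₀)) := by
      rw [← eH]; exact divDy_mem (NI.mem_subT ha1.2 ha0.2 b01) dH hHp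
    -- products
    have P1 := NI.mem_mul (NI.mem_mul hc ma0) ha0.2
    have P2 := NI.mem_mul (NI.mem_mul hc ma0) mD0
    have P3 := NI.mem_mul (NI.mem_mul hc mD3) ha0.2
    have P4 := NI.mem_mul (NI.mem_mul hc mD3) mD0
    have Q1 := NI.mem_mul (NI.mem_mul hc ha0.1) ha0.2
    have Q2 := NI.mem_mul (NI.mem_mul hc ha0.1) mU
    have Q3 := NI.mem_mul (NI.mem_mul hc mD1) ha0.2
    have Q4 := NI.mem_mul (NI.mem_mul hc mD1) mU
    simp only [sums6, Aq, Bq, Cq, List.map_cons, List.sum_cons, hd.sign]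
    cases r.σ
    · simp only [Bool.false_eq_true, ↓reduceIte]
      push_cast
      refine ⟨?_, ?_, ?_⟩
      · have := Q1.2; simp only [Aq] at i1; linarith
      · have := Q2.2; have := Q3.1; simp only [Bq] at i2; linarith
      · have := Q4.1; simp only [Cq] at i3; linarith
    · simp only [↓reduceIte]
      push_cast
      refine ⟨?_, ?_, ?_⟩
      · have := P1.1; simp only [Aq] at i1; linarith
      · have := P2.1; have := P3.2; simp only [Bq] at i2; linarith
      · have := P4.2; simp only [Cq] at i3; linarith

end Summit.CriticalPhenomena.Ising3D.Control2D
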